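import Summits.QuantumFields.BalabanUV.Beta.GradedStencilDictionary

/-!
# `BalabanUV.Beta.FP.GradedStencilMoments` — road «FP» for binder row D1, row H2-G-STENCIL (owner b2b-balaban-beta-d1-p3, journal l.20595 (3)), part 1 of 2:
# LIST MOMENTS of an3's located-pair `ℤ⁴` stencils (`GradedBubbles.Stn`), THEIR VANISHING UNDER GRADING, and the `∑'` ↔ list-sum DICTIONARY for the
# realisation `GradedStencilDictionary.real`

HONEST DEPENDENCY (page 1, mandatory): continuum YM on T⁴ ⇐ BetaPertH ∧ nine spine estimates (0/9 proved); BetaPertH ⇐ (D1) ∧ (D4) ∧ CAP+tail;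
G-an2-4 gates asym, D1 and NE2/3/4.  HONEST FRAMING (cell contract, verbatim): «discharging `BetaPertH` makes Bałaban's UV stability UNCONDITIONAL —
a real constructive-QFT result; it is NOT the continuum limit and NOT the Clay problem.»  THIS MODULE DISCHARGES NOTHING of the wall: finite list
bookkeeping over `ℤ⁴` (`[our object]`/`[folklore]` throughout; nothing cited, no `def … : Prop`, 0 sorry).  It is the generic half of the computation
`cubicGermOf (wilsonA 3) = ymGerm` (part 2, `FP/WilsonCubicGerm`): the cubic GERM of a stencil family is a pair of FIRST MOMENTS, an3-g16's
`WilsonStencilZ4.remStn` is `Graded 2`, and a graded stencil of grading `≥ 2` has no first moments.  NOT D1, NOT BetaPertH, NOT continuum, NOT Clay.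

ABSOLUTE RULE (cell charter, verbatim): «No internally-minted statement may enter as a cited fact. Every hypothesis is either kernel-proved in this package or a
verbatim quotation of a PUBLISHED theorem with page reference. The manuscript(s) under audit are NOT citable for their own disputed steps — they are the thing
under adjudication; programme-internal (2001/route/tribunal) claims are never citable.»

WHAT IS PROVED.
* §1 `mom0 V`, `momX V κ`, `momY V κ` (zeroth ∕ first row ∕ first column moment of a located-pair list `V : Stn I`, matrix-valued over the internal index `I`);
  their behaviour under `++`, `smulS`, `rowSh`, `colSh`, `rowDiff`, `colDiff` (`moments_append` … `moments_colDiff`); **`moments_of_graded`**: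
  `Graded n V → (1 ≤ n → mom0 V = 0) ∧ (2 ≤ n → ∀ κ, momX V κ = 0 ∧ momY V κ = 0)` (induction on the `Graded` derivation: a unit-step row∕column
  difference kills one more moment; translations, sums, scalars preserve the vanishing); `mom0_apply` ∕ `moments_apply` (entries).
* §2 **`hasSum_real_apply_mul`**: on ANY lattice `Λ` with frame `e`, for every weight `φ : Λ → Λ → ℝ` and internal indices `i j`,
  `HasSum (fun (x,z) ↦ real e 0 0 V (x,i) (z,j) · φ x z) (Σ_{p ∈ V} m_p i j · φ (lift e x_p) (lift e y_p))` — the (finitely supported) pairing of the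
  realised stencil against a weight over ALL pairs of sites is the list pairing; `tsum` form and the transposed-entry form (`Equiv.prodComm`).
Provenance: G-an2-4 formalisation swarm seat b2b-balaban-gan24-formalise-leaf-02 gen 36 (cross-lane on road FP), 2026-08-20.
-/

noncomputable section

namespace Summit.QuantumFields.BalabanUV.Beta.FP.GradedStencilMoments

open Finset
open scoped BigOperators
open Literature.MathematicalPhysics.QuantumFieldTheory.Balaban1983to89
open Literature.MathematicalPhysics.QuantumFieldTheory.Balaban1983to89.Beta
open Literature.MathematicalPhysics.QuantumFieldTheory.Balaban1983to89.Beta.DyadicShell (Pt)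
open Literature.MathematicalPhysics.QuantumFieldTheory.Balaban1983to89.Beta.GradedBubbles (LP Stn rowSh colSh smulS rowDiff colDiff Graded
  IsStep)
open Literature.MathematicalPhysics.QuantumFieldTheory.Balaban1983to89.Beta.BubbleTable (elemIns elemIns_apply)
open Summit.QuantumFields.BalabanUV.Beta.GradedStencilDictionary (real lift real_nil real_cons real_append)

/-! ## §1 List moments of a `ℤ⁴` located-pair stencil and their vanishing under grading -/

section Moments

variable {I : Type*}

/-- [our object] ZEROTH MOMENT of a stencil: the sum of its internal matrices. -/
def mom0 (V : Stn I) : Matrix I I ℝ := (V.map fun p => p.m).sum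

/-- [our object] FIRST ROW MOMENT along the axis `κ`: `Σ_p (x_p)_κ · m_p`. -/
def momX (V : Stn I) (κ : Fin 4) : Matrix I I ℝ := (V.map fun p => ((p.x κ : ℤ) : ℝ) • p.m).sum

/-- [our object] FIRST COLUMN MOMENT along the axis `κ`: `Σ_p (y_p)_κ · m_p`. -/
def momY (V : Stn I) (κ : Fin 4) : Matrix I I ℝ := (V.map fun p => ((p.y κ : ℤ) : ℝ) • p.m).sum

/-- [folklore] `mom0` of a cons. -/
theorem mom0_cons (p : LP I) (V : Stn I) : mom0 (p :: V) = p.m + mom0 V := rfl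

/-- [folklore] `momX` of a cons. -/
theorem momX_cons (p : LP I) (V : Stn I) (κ : Fin 4) : momX (p :: V) κ = ((p.x κ : ℤ) : ℝ) • p.m + momX V κ := rfl

/-- [folklore] `momY` of a cons. -/
theorem momY_cons (p : LP I) (V : Stn I) (κ : Fin 4) : momY (p :: V) κ = ((p.y κ : ℤ) : ℝ) • p.m + momY V κ := rfl

/-- [folklore] the three moments of the empty stencil vanish. -/
@[simp] theorem moments_nil (κ : Fin 4) : mom0 ([] : Stn I) = 0 ∧ momX ([] : Stn I) κ = 0 ∧ momY ([] : Stn I) κ = 0 := ⟨rfl, rfl, rfl⟩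

/-- [folklore] moments are additive under concatenation. -/
theorem moments_append (V W : Stn I) (κ : Fin 4) :
    mom0 (V ++ W) = mom0 V + mom0 W ∧ momX (V ++ W) κ = momX V κ + momX W κ ∧ momY (V ++ W) κ = momY V κ + momY W κ := by
  simp only [mom0, momX, momY, List.map_append, List.sum_append, and_self]

/-- [folklore] moments of a scalar multiple. -/
theorem moments_smulS (c : ℝ) (V : Stn I) (κ : Fin 4) :
    mom0 (smulS c V) = c • mom0 V ∧ momX (smulS c V) κ = c • momX V κ ∧ momY (smulS c V) κ = c • momY V κ := by
  induction V with
  | nil => simp [smulS, mom0, momX, momY]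
  | cons p V ih =>
    have h : smulS c (p :: V) = ⟨p.x, p.y, c • p.m⟩ :: smulS c V := rfl
    obtain ⟨h0, hx, hy⟩ := ih
    rw [h, mom0_cons, momX_cons, momY_cons, mom0_cons, momX_cons, momY_cons, h0, hx, hy, smul_add, smul_add, smul_add, smul_comm c,
      smul_comm c (((p.y κ : ℤ) : ℝ))]
    exact ⟨rfl, rfl, rfl⟩

/-- [folklore] moments of a ROW translation: `mom0`, `momY` unchanged, `momX` shifted by `a_κ · mom0`. -/
theorem moments_rowSh (a : Pt) (V : Stn I) (κ : Fin 4) :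
    mom0 (rowSh a V) = mom0 V ∧ momX (rowSh a V) κ = momX V κ + ((a κ : ℤ) : ℝ) • mom0 V ∧ momY (rowSh a V) κ = momY V κ := by
  induction V with
  | nil => simp [rowSh, mom0, momX, momY]
  | cons p V ih =>
    have h : rowSh a (p :: V) = ⟨p.x + a, p.y, p.m⟩ :: rowSh a V := rfl
    obtain ⟨h0, hx, hy⟩ := ih
    rw [h, mom0_cons, momX_cons, momY_cons, mom0_cons, momX_cons, momY_cons, h0, hx, hy]
    refine ⟨rfl, ?_, rfl⟩
    simp only [Pi.add_apply, Int.cast_add, add_smul, smul_add]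
    abel

/-- [folklore] moments of a COLUMN translation: `mom0`, `momX` unchanged, `momY` shifted by `a_κ · mom0`. -/
theorem moments_colSh (a : Pt) (V : Stn I) (κ : Fin 4) :
    mom0 (colSh a V) = mom0 V ∧ momX (colSh a V) κ = momX V κ ∧ momY (colSh a V) κ = momY V κ + ((a κ : ℤ) : ℝ) • mom0 V := by
  induction V with
  | nil => simp [colSh, mom0, momX, momY]
  | cons p V ih =>
    have h : colSh a (p :: V) = ⟨p.x, p.y + a, p.m⟩ :: colSh a V := rfl
    obtain ⟨h0, hx, hy⟩ := ih
    rw [h, mom0_cons, momX_cons, momY_cons, mom0_cons, momX_cons, momY_cons, h0, hx, hy]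
    refine ⟨rfl, rfl, ?_⟩
    simp only [Pi.add_apply, Int.cast_add, add_smul, smul_add]
    abel

/-- [folklore] moments of a ROW DIFFERENCE `ρ_a V − V`: `mom0 = 0`, `momX = a_κ · mom0 V`, `momY = 0`. -/
theorem moments_rowDiff (a : Pt) (V : Stn I) (κ : Fin 4) :
    mom0 (rowDiff a V) = 0 ∧ momX (rowDiff a V) κ = ((a κ : ℤ) : ℝ) • mom0 V ∧ momY (rowDiff a V) κ = 0 := by
  obtain ⟨a0, ax, ay⟩ := moments_append (rowSh a V) (smulS (-1) V) κ
  obtain ⟨s0, sx, sy⟩ := moments_smulS (-1 : ℝ) V κ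
  obtain ⟨r0, rx, ry⟩ := moments_rowSh a V κ
  rw [rowDiff, a0, ax, ay, s0, sx, sy, r0, rx, ry, neg_one_smul, neg_one_smul, neg_one_smul, add_neg_cancel, add_neg_cancel,
    add_neg_cancel_comm]
  exact ⟨rfl, rfl, rfl⟩

/-- [folklore] moments of a COLUMN DIFFERENCE `σ_a V − V`: `mom0 = 0`, `momX = 0`, `momY = a_κ · mom0 V`. -/
theorem moments_colDiff (a : Pt) (V : Stn I) (κ : Fin 4) :
    mom0 (colDiff a V) = 0 ∧ momX (colDiff a V) κ = 0 ∧ momY (colDiff a V) κ = ((a κ : ℤ) : ℝ) • mom0 V := by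
  obtain ⟨a0, ax, ay⟩ := moments_append (colSh a V) (smulS (-1) V) κ
  obtain ⟨s0, sx, sy⟩ := moments_smulS (-1 : ℝ) V κ
  obtain ⟨r0, rx, ry⟩ := moments_colSh a V κ
  rw [colDiff, a0, ax, ay, s0, sx, sy, r0, rx, ry, neg_one_smul, neg_one_smul, neg_one_smul, add_neg_cancel, add_neg_cancel,
    add_neg_cancel_comm]
  exact ⟨rfl, rfl, rfl⟩

/-- [folklore] **GRADING KILLS MOMENTS**: a stencil of grading `≥ 1` has vanishing zeroth moment, a stencil of grading `≥ 2` has vanishing zeroth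
AND first (row and column) moments — by induction on the `Graded` derivation (each unit-step row/column difference kills one more moment; translations,
sums and scalars preserve the vanishing). -/
theorem moments_of_graded {n : ℕ} {V : Stn I} (h : Graded n V) :
    (1 ≤ n → mom0 V = 0) ∧ (2 ≤ n → ∀ κ, momX V κ = 0 ∧ momY V κ = 0) := by
  induction h with
  | zero V => exact ⟨fun h => absurd h (by omega), fun h => absurd h (by omega)⟩
  | weaken _ ih => exact ⟨fun h => ih.1 (by omega), fun h => ih.2 (by omega)⟩
  | @rowDiff n V a _ _ ih =>
    refine ⟨fun _ => (moments_rowDiff a V 0).1, fun hn κ => ?_⟩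
    obtain ⟨-, hx, hy⟩ := moments_rowDiff a V κ
    rw [hx, hy, ih.1 (by omega), smul_zero]
    exact ⟨rfl, rfl⟩
  | @colDiff n V a _ _ ih =>
    refine ⟨fun _ => (moments_colDiff a V 0).1, fun hn κ => ?_⟩
    obtain ⟨-, hx, hy⟩ := moments_colDiff a V κ
    rw [hx, hy, ih.1 (by omega), smul_zero]
    exact ⟨rfl, rfl⟩
  | @rowSh n V a _ ih =>
    refine ⟨fun hn => by rw [(moments_rowSh a V 0).1]; exact ih.1 hn, fun hn κ => ?_⟩
    obtain ⟨-, hx, hy⟩ := moments_rowSh a V κ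
    obtain ⟨hX, hY⟩ := ih.2 hn κ
    rw [hx, hy, hX, hY, ih.1 (by omega), smul_zero, add_zero]
    exact ⟨rfl, rfl⟩
  | @colSh n V a _ ih =>
    refine ⟨fun hn => by rw [(moments_colSh a V 0).1]; exact ih.1 hn, fun hn κ => ?_⟩
    obtain ⟨-, hx, hy⟩ := moments_colSh a V κ
    obtain ⟨hX, hY⟩ := ih.2 hn κ
    rw [hx, hy, hX, hY, ih.1 (by omega), smul_zero, add_zero]
    exact ⟨rfl, rfl⟩
  | @append n V W _ _ ih₁ ih₂ =>
    refine ⟨fun hn => ?_, fun hn κ => ?_⟩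
    · rw [(moments_append V W 0).1, ih₁.1 hn, ih₂.1 hn, add_zero]
    · obtain ⟨-, hx, hy⟩ := moments_append V W κ
      rw [hx, hy, (ih₁.2 hn κ).1, (ih₁.2 hn κ).2, (ih₂.2 hn κ).1, (ih₂.2 hn κ).2, add_zero]
      exact ⟨rfl, rfl⟩
  | @smul n V c _ ih =>
    refine ⟨fun hn => ?_, fun hn κ => ?_⟩
    · rw [(moments_smulS c V 0).1, ih.1 hn, smul_zero]
    · obtain ⟨-, hx, hy⟩ := moments_smulS c V κ
      rw [hx, hy, (ih.2 hn κ).1, (ih.2 hn κ).2, smul_zero]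
      exact ⟨rfl, rfl⟩

/-- [folklore] ENTRIES of the zeroth moment are the list sums of the entries. -/
theorem mom0_apply (V : Stn I) (i j : I) : mom0 V i j = (V.map fun p => p.m i j).sum := by
  induction V with
  | nil => simp [mom0]
  | cons p V ih => rw [mom0_cons, Matrix.add_apply, ih, List.map_cons, List.sum_cons]

/-- [folklore] ENTRIES of the first moments are the list sums of the entries. -/
theorem moments_apply (V : Stn I) (κ : Fin 4) (i j : I) :
    momX V κ i j = (V.map fun p => p.m i j * ((p.x κ : ℤ) : ℝ)).sum ∧ momY V κ i j = (V.map fun p => p.m i j * ((p.y κ : ℤ) : ℝ)).sum := by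
  induction V with
  | nil => simp [momX, momY]
  | cons p V ih =>
    rw [momX_cons, momY_cons, Matrix.add_apply, Matrix.add_apply, Matrix.smul_apply, Matrix.smul_apply, ih.1, ih.2, List.map_cons,
      List.map_cons, List.sum_cons, List.sum_cons, smul_eq_mul, smul_eq_mul, mul_comm (p.m i j), mul_comm (p.m i j)]
    exact ⟨rfl, rfl⟩

end Moments

/-! ## §2 The dictionary: a `∑'` over all pairs of sites of the realised stencil is the list sum -/

section Dictionary

variable {Λ : Type*} [DecidableEq Λ] [AddCommGroup Λ] {I : Type*}

/-- [folklore] **`∑'` ↔ LIST SUM**: for every weight `φ`, the (finitely supported) function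
`(x, z) ↦ real e 0 0 V (x, i) (z, j) · φ x z` on `Λ × Λ` has sum `Σ_{p ∈ V} m_p i j · φ (lift e x_p) (lift e y_p)`. -/
theorem hasSum_real_apply_mul (e : Fin 4 → Λ) (V : Stn I) (i j : I) (φ : Λ → Λ → ℝ) :
    HasSum (fun xz : Λ × Λ => real e 0 0 V (xz.1, i) (xz.2, j) * φ xz.1 xz.2)
      ((V.map fun p => p.m i j * φ (lift e p.x) (lift e p.y)).sum) := by
  induction V with
  | nil =>
    simp only [real_nil, Matrix.zero_apply, zero_mul, List.map_nil, List.sum_nil]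
    exact hasSum_zero
  | cons p V ih =>
    simp only [real_cons, zero_add, Matrix.add_apply, add_mul, List.map_cons, List.sum_cons]
    refine HasSum.add ?_ ih
    have key : HasSum (fun xz : Λ × Λ => elemIns (lift e p.x) (lift e p.y) p.m (xz.1, i) (xz.2, j) * φ xz.1 xz.2)
        ((fun xz : Λ × Λ => elemIns (lift e p.x) (lift e p.y) p.m (xz.1, i) (xz.2, j) * φ xz.1 xz.2) (lift e p.x, lift e p.y)) := by
      refine hasSum_single _ fun xz hxz => ?_
      rw [elemIns_apply, if_neg, zero_mul]
      rintro ⟨h1, h2⟩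
      exact hxz (Prod.ext h1 h2)
    simpa [elemIns_apply] using key

/-- [folklore] the `∑'` form of the dictionary. -/
theorem tsum_real_apply_mul (e : Fin 4 → Λ) (V : Stn I) (i j : I) (φ : Λ → Λ → ℝ) :
    ∑' xz : Λ × Λ, real e 0 0 V (xz.1, i) (xz.2, j) * φ xz.1 xz.2 = (V.map fun p => p.m i j * φ (lift e p.x) (lift e p.y)).sum :=
  (hasSum_real_apply_mul e V i j φ).tsum_eq

/-- [folklore] the TRANSPOSED-ENTRY dictionary (column site first in the weight's arguments): summing `real e 0 0 V (z, i) (x, j) · φ x z` over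
`(x, z)`. -/
theorem hasSum_real_apply_mul_swap (e : Fin 4 → Λ) (V : Stn I) (i j : I) (φ : Λ → Λ → ℝ) :
    HasSum (fun xz : Λ × Λ => real e 0 0 V (xz.2, i) (xz.1, j) * φ xz.1 xz.2)
      ((V.map fun p => p.m i j * φ (lift e p.y) (lift e p.x)).sum) := by
  have h := hasSum_real_apply_mul e V i j fun a b => φ b a
  exact (Equiv.prodComm Λ Λ).hasSum_iff.mp (by simpa [Function.comp_def] using h)

end Dictionary

end Summit.QuantumFields.BalabanUV.Beta.FP.GradedStencilMoments
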